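import Summits.CriticalPhenomena.CardyFormulaZ2.Theorems.CardyFlipRussoVoronoiHubFromSmirnovDelaunayImageClearance

/-!
# Helper `hNearest_dist_le` — line `moebius-exact-delaunay-dilation-ward`,
# stub S3b `stub_transportHeart` (crux `VoronoiHubFromSmirnov`, stmt-CriticalPhenomena-6433)

Pulled-back Voronoi cells are small where Euclidean cells are small.  For the same nuclei
`ω ⊆ B`, a point `z` belongs to the `h`-cell of the nucleus `p` minimising `dist (h z) (h p)`.
Under the `C^{1,1}`-conformality package on the convex set `B` (`h' = h₁`, `h₁' = h₂`,
`m ≤ ‖h₁‖ ≤ Λ`, `‖h₂‖ ≤ L`) and the injectivity modulus (`dist z w ≥ R₁ ⇒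
dist (h z) (h w) ≥ η`, `R₁ ≤ m / (4 (L + 1))`), there are `C, ℓ₀ > 0` such that: if some
nucleus of `ω` is within Euclidean distance `ℓ ≤ ℓ₀` of `z ∈ B`, then the `h`-nearest nucleus
`p` of `z` is within Euclidean distance `C ℓ` of `z`.

Proof.  With `ℓ₀ = min 1 (η / (2 (Λ + L + 1)))`: the upper secant bound centred at `z`
(`dic_secant_two_sided`) gives `dist (h z) (h p) ≤ dist (h z) (h q) ≤ Λ ℓ + L ℓ² ≤ (Λ + L) ℓ
< η` for the Euclidean-near nucleus `q`, so the injectivity modulus forces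
`dist z p < R₁ ≤ m / (4 (L + 1))`; then the lower secant bound centred at `z` gives
`dist (h z) (h p) ≥ m · dist z p - L · dist z p ² ≥ (3 m / 4) dist z p`, whence
`dist z p ≤ (4 (Λ + L) / (3 m)) ℓ ≤ C ℓ` with `C = 4 (Λ + L + 1) / (3 m)`.
All [folklore]; context: I. Benjamini, O. Schramm, *Conformal invariance of Voronoi
percolation*, Comm. Math. Phys. 197 (1998) 75–107, §4.
-/

noncomputable section

namespace Summit.CriticalPhenomena.CardyFormulaZ2.Cruxes.VoronoiHubFromSmirnov.MoebiusExactDelaunayDilationWard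

open Set Metric

/-! ### The real arithmetic -/

/-- **Upper arithmetic**: from the upper secant bound `e ≤ A d + L d²` with `A ≤ Λ`,
`0 ≤ d < ℓ ≤ 1` and `ℓ ≤ η / (2 (Λ + L + 1))` we get `e ≤ (Λ + L) ℓ < η`. [folklore] -/
theorem hn_upper_arith {A Λ L ℓ η d e : ℝ} (hL : 0 ≤ L) (hΛ : 0 < Λ) (hAΛ : A ≤ Λ)
    (hℓ : 0 < ℓ) (hℓ1 : ℓ ≤ 1) (hℓη : ℓ ≤ η / (2 * (Λ + L + 1))) (hd0 : 0 ≤ d) (hd : d < ℓ)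
    (he : e ≤ A * d + L * d ^ 2) : e ≤ (Λ + L) * ℓ ∧ (Λ + L) * ℓ < η := by
  have h1 : A * d ≤ Λ * d := mul_le_mul_of_nonneg_right hAΛ hd0
  have h2 : Λ * d ≤ Λ * ℓ := mul_le_mul_of_nonneg_left hd.le hΛ.le
  have h3 : d ^ 2 ≤ ℓ * ℓ := by rw [pow_two]; exact mul_le_mul hd.le hd.le hd0 hℓ.le
  have h4 : ℓ * ℓ ≤ ℓ := by nlinarith
  have h5 : L * d ^ 2 ≤ L * ℓ := mul_le_mul_of_nonneg_left (h3.trans h4) hL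
  have h6 : ℓ * (2 * (Λ + L + 1)) ≤ η := (le_div_iff₀ (by positivity)).1 hℓη
  constructor
  · linarith
  · nlinarith

/-- **Lower arithmetic**: from the lower secant bound `A D - L D² ≤ E` with `m ≤ A`,
`0 ≤ D < R₁ ≤ m / (4 (L + 1))` we get `(3 m / 4) D ≤ E`. [folklore] -/
theorem hn_lower_arith {A m L D R₁ E : ℝ} (hL : 0 ≤ L) (hmA : m ≤ A) (hD0 : 0 ≤ D)
    (hDR : D < R₁) (hR₁m : R₁ ≤ m / (4 * (L + 1)))
    (hlow : A * D - L * D ^ 2 ≤ E) : 3 * m / 4 * D ≤ E := by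
  have hD1 : D * (4 * (L + 1)) ≤ m := (le_div_iff₀ (by positivity)).1 (hDR.le.trans hR₁m)
  have hLD : L * D ≤ m / 4 := by nlinarith
  have h1 : L * D ^ 2 ≤ m / 4 * D := by
    rw [pow_two, ← mul_assoc]; exact mul_le_mul_of_nonneg_right hLD hD0
  have h2 : m * D ≤ A * D := mul_le_mul_of_nonneg_right hmA hD0
  linarith

/-! ### The statement -/

/-- **Pulled-back Voronoi cells are small where Euclidean cells are small.**  Under the
`C^{1,1}`-conformality hypotheses on the convex set `B` (`h' = h₁`, `h₁' = h₂`,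
`m ≤ ‖h₁‖ ≤ Λ`, `‖h₂‖ ≤ L`) and the injectivity modulus `dist z w ≥ R₁ ⇒ dist (h z) (h w) ≥ η`
with `R₁ ≤ m / (4 (L + 1))`, there are `C, ℓ₀ > 0` such that for all nuclei `ω ⊆ B`, all
`z ∈ B` with a nucleus of `ω` at Euclidean distance `< ℓ ≤ ℓ₀`, and every `h`-nearest nucleus
`p ∈ ω` of `z` (`dist (h z) (h p) ≤ dist (h z) (h q)` for all `q ∈ ω`), `dist z p ≤ C ℓ`. -/
theorem hNearest_dist_le : ∀ (h h₁ h₂ : ℂ → ℂ) (B : Set ℂ) (L m Λ η R₁ : ℝ), Convex ℝ B → 0 < m → 0 ≤ L → 0 < η → 0 < R₁ → R₁ ≤ m / (4 * (L + 1)) → (∀ z ∈ B, HasDerivAt h (h₁ z) z) → (∀ z ∈ B, HasDerivAt h₁ (h₂ z) z) → (∀ z ∈ B, m ≤ ‖h₁ z‖) → (∀ z ∈ B, ‖h₁ z‖ ≤ Λ) → (∀ z ∈ B, ‖h₂ z‖ ≤ L) → (∀ z ∈ B, ∀ w ∈ B, R₁ ≤ dist z w → η ≤ dist (h z) (h w))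 → ∃ C ℓ₀ : ℝ, 0 < C ∧ 0 < ℓ₀ ∧ ∀ (ω : Set ℂ) (z p : ℂ) (ℓ : ℝ), 0 < ℓ → ℓ ≤ ℓ₀ → ω ⊆ B → z ∈ B → p ∈ ω → (∃ q ∈ ω, dist z q < ℓ) → (∀ q ∈ ω, dist (h z) (h p) ≤ dist (h z) (h q)) → dist z p ≤ C * ℓ := by
  intro h h₁ h₂ B L m Λ η R₁ hB hm hL hη hR₁ hR₁m hd1 hd2 hm1 hΛ1 hL2 hinj
  rcases Set.eq_empty_or_nonempty B with rfl | ⟨z₀, hz₀⟩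
  · exact ⟨1, 1, one_pos, one_pos, fun ω z p ℓ _ _ _ hz => absurd hz (Set.notMem_empty z)⟩
  have hΛ : 0 < Λ := hm.trans_le ((hm1 z₀ hz₀).trans (hΛ1 z₀ hz₀))
  refine ⟨4 * (Λ + L + 1) / (3 * m), min 1 (η / (2 * (Λ + L + 1))), by positivity,
    lt_min one_pos (by positivity), ?_⟩
  rintro ω z p ℓ hℓ hℓ0 hω hz hp ⟨q, hq, hzq⟩ hminp
  obtain ⟨hℓ1, hℓη⟩ := le_min_iff.1 hℓ0
  have hpB : p ∈ B := hω hp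
  have hqB : q ∈ B := hω hq
  -- upper bound through the Euclidean-near nucleus `q` (secant bound centred at `z`)
  have hzq' : dist q z < ℓ := by rwa [dist_comm] at hzq
  obtain ⟨he, heη⟩ := hn_upper_arith hL hΛ (hΛ1 z hz) hℓ hℓ1 hℓη dist_nonneg hzq'
    (dic_secant_two_sided hB hL hd1 hd2 hL2 hz hqB).2
  have hzp : dist (h z) (h p) ≤ (Λ + L) * ℓ :=
    (hminp q hq).trans (by rw [dist_comm]; exact he)
  -- the injectivity modulus, contrapositive: `dist z p < R₁`
  have hDR : dist p z < R₁ := by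
    rw [dist_comm]
    by_contra hcon
    exact absurd (hinj z hz p hpB (not_lt.1 hcon)) (not_le.2 (hzp.trans_lt heη))
  -- lower secant bound centred at `z`
  have h34 := hn_lower_arith hL (hm1 z hz) dist_nonneg hDR hR₁m
    (dic_secant_two_sided hB hL hd1 hd2 hL2 hz hpB).1
  rw [dist_comm (h p) (h z), dist_comm p z] at h34
  -- conclusion
  rw [div_mul_eq_mul_div, le_div_iff₀ (by positivity)]
  nlinarith

end Summit.CriticalPhenomena.CardyFormulaZ2.Cruxes.VoronoiHubFromSmirnov.MoebiusExactDelaunayDilationWard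

end
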